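import Literature.NumberTheory.LFunctions.PatelYangBlockB
import Literature.NumberTheory.LFunctions.FourthTestLogPhase
import Literature.NumberTheory.LFunctions.LogPhasePartialSummation
import Literature.NumberTheory.LFunctions.LehmanCriticalLineBoundProofs
import HarnessLib

/-!
# Block bounds for `∑ n^{-1/2-it}` in the three ranges (Patel–Yang, Lemmas 3.2–3.5, per block)

Topic `Literature/NumberTheory/LFunctions`. Patel–Yang 2024, §3: the main sum
`∑_{n ≤ √(t/2π)} n^{-1/2-it}` of the Riemann–Siegel formula is split into an initial segment
(trivial bound, Lemma 3.2), a middle range treated block-by-block with the explicit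
fourth-derivative test (Lemma 3.3) and a top range treated block-by-block with the
`ABA³B`-process (Lemmas 3.4–3.5); in each block `(a, b] ⊆ (a, ha]` partial summation converts a
uniform bound for `∑_{a<n≤L} n^{-it}` into a bound for `∑_{a<n≤b} n^{-1/2-it}` with the factor
`a^{-1/2}`. This file PROVES the three per-block bounds in a common format, from
`Literature.NumberTheory.LFunctions.VdC.topBlock_le`, `…fourthTest_logPhase`,
`…norm_sum_cpow_le_of_partial'` and `…SiegelIntegral.sum_rpow_neg_half_le`.

## Main results

* `Literature.NumberTheory.LFunctions.VdC.topBlock_cpow_le` — top range: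
  `‖∑_{a<n≤b} n^{-(1/2+it)}‖ ≤ a^{-1/2} 𝓑(t, h, η, a, q)`.
* `Literature.NumberTheory.LFunctions.VdC.midBlock_cpow_le` — middle range:
  `‖∑_{a<n≤b} n^{-(1/2+it)}‖ ≤ a^{-1/2} yangKRHS η h⁴ 4 ((h-1)a) (6K/(ha)⁴)`.
* `Literature.NumberTheory.LFunctions.VdC.initial_cpow_le` — `‖∑_{n≤M} n^{-(1/2+it)}‖ ≤ 2√M`.

## References

* D. Patel, A. Yang, *An explicit sub-Weyl bound for `ζ(1/2 + it)`*, J. Number Theory 262 (2024),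
  Lemmas 3.2–3.5. [cite: PatelYang2024, §3]
-/

noncomputable section

open Real Set

namespace Literature.NumberTheory.LFunctions
namespace VdC

/-- `topBlockBound ≥ 0`. [folklore] -/
theorem topBlockBound_nonneg (t h η a q : ℝ) : 0 ≤ topBlockBound t h η a q := Real.sqrt_nonneg _

/-- Bridge: the `ℤ`-indexed block sum of `e(f(n))` with natural endpoints is the `ℕ`-indexed one.
[folklore] -/
theorem sum_e_phaseD_int_eq_nat (t : ℝ) (a L : ℕ) :
    ∑ n ∈ Finset.Ioc (a : ℤ) (L : ℤ), e (phaseD t 0 n) = ∑ n ∈ Finset.Ioc a L, e (phaseD t 0 n) := by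
  rw [sum_Ioc_int_eq_nat (fun n : ℤ => e (phaseD t 0 n)) a L]
  simp only [Int.cast_natCast]

/-- **Top-range block** (Patel–Yang, Lemma 3.5 step): for `t > 0`, `1 < h`, `η > 0`, naturals
`1 ≤ a`, `b ≤ ha` and `q ≥ 1`, `‖∑_{a<n≤b} n^{-(1/2+it)}‖ ≤ a^{-1/2} 𝓑(t, h, η, a, q)`.
[cite: PatelYang2024, Lemma 3.5] -/
theorem topBlock_cpow_le {t h η : ℝ} (ht : 0 < t) (hh1 : 1 < h) (hη : 0 < η) {a b : ℕ}
    (ha : 1 ≤ a) (hb : (b : ℝ) ≤ h * a) {q : ℕ} (hq : 1 ≤ q) :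
    ‖∑ n ∈ Finset.Ioc a b, (n : ℂ) ^ (-((1 / 2 : ℂ) + t * Complex.I))‖
      ≤ (a : ℝ) ^ (-(1 / 2 : ℝ)) * topBlockBound t h η a q := by
  refine norm_sum_cpow_le_of_partial' ha (topBlockBound_nonneg _ _ _ _ _) fun L hL1 hL2 => ?_
  have hL : ((L : ℤ) : ℝ) ≤ h * ((a : ℤ) : ℝ) := by
    have : (L : ℝ) ≤ b := by exact_mod_cast hL2
    push_cast; linarith
  have h := topBlock_le (η := η) ht hh1 hη (a := (a : ℤ)) (L := (L : ℤ)) (by exact_mod_cast ha)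
    (by exact_mod_cast hL1) hL hq
  rw [sum_e_phaseD_int_eq_nat] at h
  simpa only [Int.cast_natCast] using h

/-- **Middle-range block** (Patel–Yang, Lemma 3.3 per block): for `t > 0`, `1 < h`, `η > 0`,
naturals `1 ≤ a`, `b ≤ ha`,
`‖∑_{a<n≤b} n^{-(1/2+it)}‖ ≤ a^{-1/2} · yangKRHS η h⁴ 4 ((h-1)a) (6(t/2π)/(ha)⁴)`.
[cite: PatelYang2024, Lemma 3.3] -/
theorem midBlock_cpow_le {t h η : ℝ} (ht : 0 < t) (hh1 : 1 < h) (hη : 0 < η) {a b : ℕ}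
    (ha : 1 ≤ a) (hb : (b : ℝ) ≤ h * a) :
    ‖∑ n ∈ Finset.Ioc a b, (n : ℂ) ^ (-((1 / 2 : ℂ) + t * Complex.I))‖
      ≤ (a : ℝ) ^ (-(1 / 2 : ℝ))
        * yangKRHS η (h ^ 4) 4 ((h - 1) * a) (6 * (t / (2 * π)) / (h * a) ^ 4) := by
  have hh := hh1.le
  have ha0 : (0 : ℝ) < a := by exact_mod_cast (show 0 < a by omega)
  have hh4 : 1 ≤ h ^ 4 := one_le_pow₀ hh
  have hlam : 0 < 6 * (t / (2 * π)) / (h * a) ^ 4 := by positivity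
  have hB0 : 0 ≤ yangKRHS η (h ^ 4) 4 ((h - 1) * a) (6 * (t / (2 * π)) / (h * a) ^ 4) :=
    yangKRHS_nonneg hη hh4 (by norm_num) (by nlinarith) hlam
  refine norm_sum_cpow_le_of_partial' ha hB0 fun L hL1 hL2 => ?_
  have hL : ((L : ℤ) : ℝ) ≤ h * ((a : ℤ) : ℝ) := by
    have : (L : ℝ) ≤ b := by exact_mod_cast hL2
    push_cast; linarith
  have h := fourthTest_logPhase (η := η) ht hη hh (a := (a : ℤ)) (b := (L : ℤ)) (by exact_mod_cast ha)
    (by exact_mod_cast hL1) hL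
  rw [sum_e_phaseD_int_eq_nat] at h
  refine h.trans ?_
  push_cast
  refine yangKRHS_mono hη hh4 (by norm_num) ?_ ?_ hlam
  · have : (a : ℝ) + 1 ≤ L := by exact_mod_cast hL1
    linarith
  · push_cast at hL; linarith

/-- **Initial segment** (Patel–Yang, Lemma 3.2): `‖∑_{n≤M} n^{-(1/2+it)}‖ ≤ 2√M`. [cite: PatelYang2024, Lemma 3.2] -/
theorem initial_cpow_le (t : ℝ) (M : ℕ) :
    ‖∑ n ∈ Finset.Icc 1 M, (n : ℂ) ^ (-((1 / 2 : ℂ) + t * Complex.I))‖ ≤ 2 * Real.sqrt M := by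
  rcases lt_or_ge M 2 with hM | hM
  · interval_cases M
    · simp
    · rw [Finset.Icc_self, Finset.sum_singleton]
      simp
  calc ‖∑ n ∈ Finset.Icc 1 M, (n : ℂ) ^ (-((1 / 2 : ℂ) + t * Complex.I))‖
      ≤ ∑ n ∈ Finset.Icc 1 M, ‖(n : ℂ) ^ (-((1 / 2 : ℂ) + t * Complex.I))‖ := norm_sum_le _ _
    _ = ∑ n ∈ Finset.Icc 1 M, (n : ℝ) ^ (-(1 / 2 : ℝ)) := by
        refine Finset.sum_congr rfl fun n hn => ?_
        rw [Finset.mem_Icc] at hn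
        rw [Complex.norm_natCast_cpow_of_pos (by omega)]
        congr 1
        simp
    _ ≤ 2 * Real.sqrt M + 1 - 3 / 2 * Real.sqrt 2 := SiegelIntegral.sum_rpow_neg_half_le hM
    _ ≤ 2 * Real.sqrt M := by
        have : (1.41 : ℝ) ≤ Real.sqrt 2 := by
          rw [Real.le_sqrt (by norm_num) (by norm_num)]; norm_num
        linarith

end VdC
end Literature.NumberTheory.LFunctions
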